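import Mathlib
import Summits.PneNP.PneNP.Theses.OneSlice
import Summits.PneNP.PneNP.Theorems.OneSliceSliceTargetSplit
import Summits.PneNP.PneNP.Theorems.OneSliceMonotoneContinuationTransportMono

/-!
# Route OneSlice, crux `MonotoneContinuation` (stmt-PneNP-18471), line `Sketch_ideator1_r1` (ProfileLine) — sub-goal `transport_tower_down`

TOWER PROPERTY OF THE TRANSPORT, DOWNWARD. For `j ≤ r ≤ e(y)` the slice-`j` transport
`transport j g y = (Σ_{x ∈ nbhd j y} g x) / #(nbhd j y)` (the average of `g` over the `j`-subsets of `supp y`)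
equals the average over the `r`-subsets `u` of `supp y` (`nbhd r y`) of the slice-`j` transport at `u` (the
average of `g` over the `j`-subsets of `u`): iterated conditioning. Proof: on `nbhd r y` the inner denominator
`#(nbhd j u) = C(r, j)` is constant and `nbhd j u = {x ∈ nbhd j y : supp x ⊆ supp u}`; swapping the two sums,
every `x ∈ nbhd j y` lies below exactly `C(e(y) - j, r - j)` vectors `u ∈ nbhd r y` (a squeezed slice,
`stub_transportMono_card_between`), so `Σ_{u ∈ nbhd r y} T_j g u = C(e(y) - j, r - j)·(Σ_{x ∈ nbhd j y} g x) / C(r, j)`;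
dividing by `#(nbhd r y) = C(e(y), r)` and using `C(e(y), r)·C(r, j) = C(e(y), j)·C(e(y) - j, r - j)`
(`Nat.choose_mul`) gives `T_j g y`.
-/

set_option linter.dupNamespace false -- `Summit.PneNP.PneNP.…`: summit = sub-problem (D-0017)

namespace Summit.PneNP.PneNP.Theorems.MonotoneContinuation

open Literature.Computability.Complexity hiding supp mem_supp
open Finset hiding slice
open Classical
open Summit.PneNP.PneNP.Theorems.ConstantBand.Negative (Edge slice)
open Summit.PneNP.PneNP.Theorems.SliceACZero.Negative (supp mem_supp card_supp)
open Summit.PneNP.PneNP.Theorems.SliceTargetSplit (Comp nbhd mem_nbhd transport card_nbhd_of_le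
  supp_subset_of_comp_of_le comp_iff_supp)

noncomputable section

variable {n : ℕ}

/-- Inner neighbourhoods along a downward neighbourhood: for `j ≤ r ≤ e(y)` and `u ∈ nbhd r y`, the slice-`j`
vectors comparable with `u` are the members of `nbhd j y` whose support lies in `supp u`. [folklore] -/
theorem towerDown_nbhd_eq_filter {j r : ℕ} {y u : Edge n → Bool} (hjr : j ≤ r) (hry : r ≤ edgeCount y)
    (hu : u ∈ nbhd r y) : nbhd j u = (nbhd j y).filter fun x => supp x ⊆ supp u := by
  obtain ⟨hur, hcu⟩ := mem_nbhd.1 hu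
  have huy : supp u ⊆ supp y := supp_subset_of_comp_of_le hcu (by rw [hur]; exact hry)
  ext x
  rw [mem_filter, mem_nbhd, mem_nbhd]
  constructor
  · rintro ⟨hxj, hc⟩
    have hxu : supp x ⊆ supp u := supp_subset_of_comp_of_le hc (by rw [hxj, hur]; exact hjr)
    exact ⟨⟨hxj, comp_iff_supp.2 (Or.inl (hxu.trans huy))⟩, hxu⟩
  · rintro ⟨⟨hxj, -⟩, hxu⟩
    exact ⟨hxj, comp_iff_supp.2 (Or.inl hxu)⟩

/-- Each `x ∈ nbhd j y` lies below exactly `C(e(y) - j, r - j)` vectors of `nbhd r y` (`j ≤ r ≤ e(y)`): these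
form the squeezed slice of weight-`r` vectors `u` with `supp x ⊆ supp u ⊆ supp y`. [folklore] -/
theorem towerDown_card_filter_supset {j r : ℕ} {y x : Edge n → Bool} (hjr : j ≤ r) (hry : r ≤ edgeCount y)
    (hx : x ∈ nbhd j y) : #((nbhd r y).filter fun u => supp x ⊆ supp u) = (edgeCount y - j).choose (r - j) := by
  obtain ⟨hxj, hc⟩ := mem_nbhd.1 hx
  have hxy : supp x ⊆ supp y := supp_subset_of_comp_of_le hc (by rw [hxj]; exact hjr.trans hry)
  rw [stub_transportMono_nbhd_eq_between_lower hry, stub_transportMono_between_filter_supset (empty_subset _),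
    stub_transportMono_card_between hxy (by rw [card_supp, hxj]; exact hjr), card_supp, card_supp, hxj]

/-- The double sum behind the tower property: for `j ≤ r ≤ e(y)`,
`Σ_{u ∈ nbhd r y} T_j g u = C(e(y) - j, r - j)·(Σ_{x ∈ nbhd j y} g x) / C(r, j)`. [folklore] -/
theorem towerDown_sum_transport {j r : ℕ} (g : (Edge n → Bool) → ℝ) {y : Edge n → Bool} (hjr : j ≤ r)
    (hry : r ≤ edgeCount y) :
    ∑ u ∈ nbhd r y, transport j g u =
      ((edgeCount y - j).choose (r - j) : ℝ) * (∑ x ∈ nbhd j y, g x) / (r.choose j : ℝ) := by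
  -- constant inner denominator `C(r, j)` and inner neighbourhoods as filters of `nbhd j y`
  have hinner : ∀ u ∈ nbhd r y, transport j g u =
      (∑ x ∈ (nbhd j y).filter (fun x => supp x ⊆ supp u), g x) / (r.choose j : ℝ) := by
    intro u hu
    have hur : edgeCount u = r := (mem_nbhd.1 hu).1
    rw [transport, card_nbhd_of_le (by rw [hur]; exact hjr), hur, towerDown_nbhd_eq_filter hjr hry hu]
  rw [sum_congr rfl hinner, ← sum_div]
  congr 1
  -- swap the two sums and count
  calc ∑ u ∈ nbhd r y, ∑ x ∈ (nbhd j y).filter (fun x => supp x ⊆ supp u), g x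
      = ∑ x ∈ nbhd j y, ∑ _u ∈ (nbhd r y).filter (fun u => supp x ⊆ supp u), g x := by
        simp_rw [sum_filter]
        exact sum_comm
    _ = ∑ x ∈ nbhd j y, ((edgeCount y - j).choose (r - j) : ℝ) * g x := by
        refine sum_congr rfl fun x hx => ?_
        rw [sum_const, nsmul_eq_mul, towerDown_card_filter_supset hjr hry hx]
    _ = ((edgeCount y - j).choose (r - j) : ℝ) * ∑ x ∈ nbhd j y, g x := by rw [mul_sum]

/-- **Tower property of the transport, downward** (sub-goal `transport_tower_down` of the line
`Sketch_ideator1_r1`): for `j ≤ r ≤ e(y)` and every real `g` on the edge cube of `K_n`, the slice-`j` transport at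
`y` is the average over `nbhd r y` (the `r`-subsets `u` of `supp y`) of the slice-`j` transport at `u` — averaging
over `j`-subsets of `supp y` directly or through a uniformly random intermediate `r`-subset is the same. [folklore] -/
theorem transport_tower_down :
  ∀ (n j r : ℕ) (g : (Edge n → Bool) → ℝ) (y : Edge n → Bool), j ≤ r → r ≤ edgeCount y →
    transport j g y = (∑ u ∈ nbhd r y, transport j g u) / #(nbhd r y) := by
  intro n j r g y hjr hry
  rw [towerDown_sum_transport g hjr hry, transport, card_nbhd_of_le (hjr.trans hry), card_nbhd_of_le hry]
  -- positivity of the three binomial denominators and the subset-of-a-subset identity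
  have ha : (0 : ℝ) < (edgeCount y).choose j := by exact_mod_cast Nat.choose_pos (hjr.trans hry)
  have hb : (0 : ℝ) < r.choose j := by exact_mod_cast Nat.choose_pos hjr
  have hd : (0 : ℝ) < (edgeCount y).choose r := by exact_mod_cast Nat.choose_pos hry
  have hid : ((edgeCount y).choose r : ℝ) * (r.choose j) =
      ((edgeCount y).choose j : ℝ) * ((edgeCount y - j).choose (r - j)) := by
    exact_mod_cast Nat.choose_mul (n := edgeCount y) hjr
  rw [div_div, div_eq_div_iff ha.ne' (mul_ne_zero hb.ne' hd.ne')]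
  linear_combination (∑ x ∈ nbhd j y, g x) * hid

end

end Summit.PneNP.PneNP.Theorems.MonotoneContinuation
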